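import Mathlib.LinearAlgebra.Matrix.PosDef
import Mathlib.LinearAlgebra.Matrix.Kronecker
import Mathlib.Analysis.Matrix.Order
import Mathlib.Algebra.QuadraticDiscriminant
import Mathlib.Tactic.Linarith
import Mathlib.Tactic.Positivity
import Mathlib.Tactic.Ring
import HarnessLib

/-!
# Rayleigh suprema of tensor-product forms: the «multiplicative × profile» step of mollifier optimality

Topic `Literature/NumberTheory/LFunctions` (namespace
`Literature.NumberTheory.LFunctions.MollifierTensorOptimality`). PROVED, elementary linear algebra
over `ℝ`; no named facts are introduced (D-0026). Typed for the cell `landau-siegel` (rung F-S3,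
sub-cell §B-fam) as the abstract half of the derivation recorded in `B-fam/num-1/Q08-PROBE.md` §2
and in `MollifierEulerCorrection` (the prime-by-prime half), in support of the C0⁺ / famE-09 row
(`KMV2000.LinearMollifierOptimality`): a DERIVATION about the main-term forms of the cited source.

## What the source prints (held text, read 2026-08-26)

E. Kowalski, P. Michel, J. VanderKam, J. reine angew. Math. 526 (2000) 1–34
[held: `paper:doi-10-1515-crll-2000-074`]: the first and second harmonic mollified moments of
`Λ(f,½)` for the mollifier (9) are, at leading order, a LINEAR form (20) and a QUADRATIC form
(Prop 5.1 p. 18, (30)–(33)) in the profile `P`, with arithmetic constants `η₁ = ζ(2)`, `η₂ = ζ(2)²`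
coming from convergent Euler products (pp. 11, 15–16); the non-vanishing proportion is bounded
below by the Cauchy–Schwarz ratio (32) of Theorem 6.1.

## What is typed here (derivation)

For a general coefficient array `x_m = μ(m)·F(m, log(M/m)/log M)` with `F` in the span of
(multiplicative function of the squarefree kernel) × (profile), the leading-order linear form is a
PURE tensor `⊗_p a_p ⊗ λ` and the quadratic form a tensor (Kronecker) product `⊗_p H_p ⊗ B` of the
local forms of `MollifierEulerCorrection` with the profile forms of Theorem 6.1. The supremum of
the Cauchy–Schwarz ratio over such a tensor space FACTORISES; this file proves the two abstract
facts that make it so: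
* `dotProduct_sq_le` : for a real positive semi-definite matrix `H` and a solution `y` of
  `H y = ℓ`, every `x` satisfies `(ℓ·x)² ≤ (ℓ·y)·(xᵀHx)` — the Rayleigh quotient `(ℓ·x)²/(xᵀHx)` is
  at most `ℓ·y = ℓᵀH⁻¹ℓ`, and `dotProduct_sq_eq_at_solution` : it is attained at `x = y`;
* `kronVec_mulVec`, `kronVec_dotProduct` : Kronecker products act factor-wise on pure tensors;
* `tensor_dotProduct_sq_le` : for `H₁ y₁ = ℓ₁`, `H₂ y₂ = ℓ₂` (both PSD), every `x` on the product
  index set satisfies `((ℓ₁⊗ℓ₂)·x)² ≤ (ℓ₁·y₁)(ℓ₂·y₂)·(xᵀ(H₁ ⊗ₖ H₂)x)`, and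
  `tensor_dotProduct_sq_eq_at_solution` : equality at the pure tensor `x = y₁ ⊗ y₂` — i.e. the
  supremum over the WHOLE tensor space equals the product of the factor suprema and is attained on a
  pure tensor. Iterating over the primes (each local factor `≤ 1` with equality at `1/ψ(p)`,
  `MollifierEulerCorrection.firstLocal_sq_le_secondLocal`) and the profile factor
  (`OnePieceMollifierCeiling.propIS_le`) gives: KMV's `ψ⁻¹·x²` is the leading-order optimum over all
  such arrays, value `Δ/(2(1+Δ))` (all forms).
WHAT THIS IS NOT: no identification of KMV's finite-`q` moments with these forms (that is famE-01 /
the D-fam-1 forms with a `g`-slot, typed elsewhere), nothing about coefficient arrays outside the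
tensor span (anatomy-dependent designs), nothing about Landau–Siegel zeros.

## References

* [KowalskiMichelVanderKam2000] (9) p. 7, (20) p. 11, Prop 5.1 p. 18, Thm 6.1 (32) p. 20 (held).
-/

namespace Literature.NumberTheory.LFunctions.MollifierTensorOptimality

open Matrix
open scoped Kronecker

variable {n m : Type*} [Fintype n] [Fintype m]

omit [Fintype n] in
/-- A real positive semi-definite matrix is symmetric (plumbing: `Hᴴ = Hᵀ` over `ℝ`). [folklore] -/
private theorem transpose_eq_of_posSemidef (H : Matrix n n ℝ) (hH : H.PosSemidef) : Hᵀ = H := by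
  have h := hH.1
  rwa [IsHermitian, conjTranspose_eq_transpose_of_trivial] at h

/-- A real positive semi-definite matrix has a non-negative quadratic form (plumbing: `star v = v`
over `ℝ`). [folklore] -/
private theorem quadForm_nonneg (H : Matrix n n ℝ) (hH : H.PosSemidef) (v : n → ℝ) :
    0 ≤ v ⬝ᵥ H *ᵥ v := by
  have h := hH.dotProduct_mulVec_nonneg v
  rwa [star_trivial] at h

/-- **Rayleigh–Cauchy–Schwarz bound.** For a real positive semi-definite matrix `H`, a vector `ℓ`
in its range and any solution `y` of `H y = ℓ`: every `x` satisfies `(ℓ·x)² ≤ (ℓ·y)·(xᵀ H x)`.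
Hence the Cauchy–Schwarz ratio `(ℓ·x)²/(xᵀHx)` of a (first moment)²/(second moment) functional
with linear form `ℓ` and quadratic form `H` is at most `ℓ·y = ℓᵀH⁻¹ℓ` — the «pencil optimum» the
cell's evaluators report. Proof: `t ↦ (x − t y)ᵀH(x − t y) ≥ 0` has non-positive discriminant.
[cite: KowalskiMichelVanderKam2000, Thm 6.1 (32) p. 20 («Max_{P,Δ} R(P,Q)» as a Rayleigh quotient) (derivation: abstract form)] -/
theorem dotProduct_sq_le (H : Matrix n n ℝ) (hH : H.PosSemidef) (ℓ y x : n → ℝ)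
    (hy : H *ᵥ y = ℓ) : (ℓ ⬝ᵥ x) ^ 2 ≤ (ℓ ⬝ᵥ y) * (x ⬝ᵥ H *ᵥ x) := by
  have hsym : Hᵀ = H := transpose_eq_of_posSemidef H hH
  -- yᵀ H x = ℓ·x (symmetry) and yᵀ H y = ℓ·y
  have hyx : y ⬝ᵥ H *ᵥ x = ℓ ⬝ᵥ x := by
    rw [dotProduct_mulVec, ← mulVec_transpose, hsym, hy]
  have hxy : x ⬝ᵥ H *ᵥ y = ℓ ⬝ᵥ x := by rw [hy, dotProduct_comm]
  have hyy : y ⬝ᵥ H *ᵥ y = ℓ ⬝ᵥ y := by rw [hy, dotProduct_comm]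
  -- the quadratic t ↦ (x - t y)ᵀ H (x - t y)
  have hquad : ∀ t : ℝ,
      0 ≤ (ℓ ⬝ᵥ y) * (t * t) + (-(2 * (ℓ ⬝ᵥ x))) * t + x ⬝ᵥ H *ᵥ x := by
    intro t
    have h0 := quadForm_nonneg H hH (x - t • y)
    have hexp : (x - t • y) ⬝ᵥ H *ᵥ (x - t • y)
        = x ⬝ᵥ H *ᵥ x - t * (x ⬝ᵥ H *ᵥ y) - t * (y ⬝ᵥ H *ᵥ x) + t * t * (y ⬝ᵥ H *ᵥ y) := by
      rw [mulVec_sub, mulVec_smul, sub_dotProduct, dotProduct_sub, dotProduct_sub, dotProduct_smul,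
        smul_dotProduct, smul_dotProduct, dotProduct_smul]
      simp only [smul_eq_mul]
      ring
    rw [hexp, hxy, hyx, hyy] at h0
    nlinarith [h0]
  have hdisc := discrim_le_zero hquad
  unfold discrim at hdisc
  nlinarith [hdisc]

/-- **The bound is attained at the solution**: with `H y = ℓ`, `(ℓ·y)² = (ℓ·y)·(yᵀHy)`, so the
supremum of the Rayleigh quotient is exactly `ℓ·y` (when `ℓ·y > 0`).
[cite: KowalskiMichelVanderKam2000, Thm 6.1 (32) p. 20 (derivation: abstract form)] -/
theorem dotProduct_sq_eq_at_solution (H : Matrix n n ℝ) (ℓ y : n → ℝ) (hy : H *ᵥ y = ℓ) :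
    (ℓ ⬝ᵥ y) ^ 2 = (ℓ ⬝ᵥ y) * (y ⬝ᵥ H *ᵥ y) := by
  rw [hy, dotProduct_comm y ℓ]; ring

/-- The pure tensor (Kronecker product) of two coefficient vectors: `(v ⊗ w)(i,j) = v i · w j`.
[cite: KowalskiMichelVanderKam2000, §4.1 p. 11 and §5.1 pp. 15–16 (Euler products of local factors) (derivation: tensor bookkeeping)] -/
def kronVec (v : n → ℝ) (w : m → ℝ) : n × m → ℝ := fun p => v p.1 * w p.2

/-- Kronecker products act factor-wise on pure tensors: `(A ⊗ₖ B)(v ⊗ w) = (A v) ⊗ (B w)`.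
[cite: KowalskiMichelVanderKam2000, §5.1 pp. 15–16 (derivation: tensor bookkeeping)] -/
theorem kronVec_mulVec (A : Matrix n n ℝ) (B : Matrix m m ℝ) (v : n → ℝ) (w : m → ℝ) :
    (A ⊗ₖ B) *ᵥ kronVec v w = kronVec (A *ᵥ v) (B *ᵥ w) := by
  funext p
  rcases p with ⟨i, j⟩
  simp only [mulVec, dotProduct, kronVec, kroneckerMap_apply]
  rw [Fintype.sum_prod_type, Fintype.sum_mul_sum]
  apply Finset.sum_congr rfl
  intro k _
  apply Finset.sum_congr rfl
  intro l _
  ring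

/-- Dot products of pure tensors factorise: `(v ⊗ w)·(v' ⊗ w') = (v·v')(w·w')`.
[cite: KowalskiMichelVanderKam2000, §5.1 pp. 15–16 (derivation: tensor bookkeeping)] -/
theorem kronVec_dotProduct (v v' : n → ℝ) (w w' : m → ℝ) :
    kronVec v w ⬝ᵥ kronVec v' w' = (v ⬝ᵥ v') * (w ⬝ᵥ w') := by
  simp only [dotProduct, kronVec]
  rw [Fintype.sum_prod_type, Fintype.sum_mul_sum]
  apply Finset.sum_congr rfl
  intro k _
  apply Finset.sum_congr rfl
  intro l _
  ring

/-- **Tensor Rayleigh bound.** For real positive semi-definite `H₁, H₂` with `H₁ y₁ = ℓ₁`,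
`H₂ y₂ = ℓ₂`, EVERY vector `x` on the product index set (not only pure tensors) satisfies
`((ℓ₁ ⊗ ℓ₂)·x)² ≤ (ℓ₁·y₁)(ℓ₂·y₂) · xᵀ(H₁ ⊗ₖ H₂)x`: the supremum of the Cauchy–Schwarz ratio over
the whole tensor space is at most the PRODUCT of the factor suprema. (Applied prime by prime and
to the profile factor: no coefficient array in the span of multiplicative × profile designs beats
the product of the local optima.)
[cite: KowalskiMichelVanderKam2000, Thm 6.1 (32) p. 20 with §4.1/§5.1 (η₁ = ζ(2), η₂ = ζ(2)²) (derivation: tensor factorisation of the leading-order forms)] -/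
theorem tensor_dotProduct_sq_le (H₁ : Matrix n n ℝ) (H₂ : Matrix m m ℝ)
    (h₁ : H₁.PosSemidef) (h₂ : H₂.PosSemidef) (ℓ₁ y₁ : n → ℝ) (ℓ₂ y₂ : m → ℝ)
    (hy₁ : H₁ *ᵥ y₁ = ℓ₁) (hy₂ : H₂ *ᵥ y₂ = ℓ₂) (x : n × m → ℝ) :
    (kronVec ℓ₁ ℓ₂ ⬝ᵥ x) ^ 2 ≤ ((ℓ₁ ⬝ᵥ y₁) * (ℓ₂ ⬝ᵥ y₂)) * (x ⬝ᵥ (H₁ ⊗ₖ H₂) *ᵥ x) := by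
  have hK : (H₁ ⊗ₖ H₂).PosSemidef := h₁.kronecker h₂
  have hsol : (H₁ ⊗ₖ H₂) *ᵥ kronVec y₁ y₂ = kronVec ℓ₁ ℓ₂ := by
    rw [kronVec_mulVec, hy₁, hy₂]
  have h := dotProduct_sq_le (H₁ ⊗ₖ H₂) hK (kronVec ℓ₁ ℓ₂) (kronVec y₁ y₂) x hsol
  rwa [kronVec_dotProduct] at h

/-- **… and it is attained on a pure tensor**: at `x = y₁ ⊗ y₂` the ratio equals
`(ℓ₁·y₁)(ℓ₂·y₂)`, so sup over the tensor space = product of the factor sups, with a pure-tensor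
maximiser (for KMV: `g = 1/ψ` at every prime times the profile `x²`).
[cite: KowalskiMichelVanderKam2000, (9) p. 7 with Thm 6.1 p. 20 (derivation)] -/
theorem tensor_dotProduct_sq_eq_at_solution (H₁ : Matrix n n ℝ) (H₂ : Matrix m m ℝ)
    (ℓ₁ y₁ : n → ℝ) (ℓ₂ y₂ : m → ℝ) (hy₁ : H₁ *ᵥ y₁ = ℓ₁) (hy₂ : H₂ *ᵥ y₂ = ℓ₂) :
    (kronVec ℓ₁ ℓ₂ ⬝ᵥ kronVec y₁ y₂) ^ 2
      = ((ℓ₁ ⬝ᵥ y₁) * (ℓ₂ ⬝ᵥ y₂)) * (kronVec y₁ y₂ ⬝ᵥ (H₁ ⊗ₖ H₂) *ᵥ kronVec y₁ y₂) := by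
  rw [kronVec_mulVec, hy₁, hy₂, kronVec_dotProduct, kronVec_dotProduct, dotProduct_comm y₁ ℓ₁,
    dotProduct_comm y₂ ℓ₂]
  ring

end Literature.NumberTheory.LFunctions.MollifierTensorOptimality
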